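/-
Copyright (c) 2026 the pub-hodgecm-mathlib formalisation cell (harness21).  R90-TF SLAB, section S10 (Rogawski 1990, §13.6–13.8 read at `v`),
prover R90-C138-p08 (g0) — DEAL #18 (R90-C138-plan (g2) 2026-09-05T00:55:28Z; (M-c) withdrawn as a letter by p06 (g0) 01:07:37Z — kept as the generic `K`-line brick);
h413 = `stmt-HodgeConjecture-24833`, route `HCCMUnconditional`.
-/
import Summits.HodgeConjecture.HodgeConjecture.Theorems.R90S10FrozenDatumDefs       -- ★ S10 FILE C2 (`Gqs`, `Pl`, `cmLocalIntegralLevel`, `qsForm`)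
import Literature.NumberTheory.Automorphic.CMPrincipalSeriesSpherical             -- ★ `isSpherical_cmPrincipalSeries` (every `N`, EVERY finite place: `i_G(χ)^{K_v}` is a line for unramified `χ`)
import HarnessLib

/-!
# R90-TF ∕ S10 — THE `K_w`-LINE OF AN UNRAMIFIED PRINCIPAL SERIES, TRANSPORTED TO ANY REALISATION (generic brick for the (β″) payers, split and non-split)
# (`Theorems/R90S10SphericalLineOfEquivPrincipalSeries.lean`; ns `Summit.HodgeConjecture.HodgeConjecture.R90.S10`; LAW L9: ★ imports only; THEOREMS ONLY — no `def`, no instance, no notation, no `sorry`)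

Print: [Rogawski1990] §4.5 p. 45, §4.7 pp. 50–51 (Iwasawa decomposition `G = BK`, the spherical vector `g ↦ δ^{1/2}χ(b(g))`), §12.2 pp. 173–174; [CartierCorvallis1979] §IV (3.3),
Thm. 4.1 (`dim i_G(χ)^K = 1` for unramified `χ`).

## WHAT THIS FILE PROVES
LETTER (3) `PSLocalCharTransferLetter` (★ p863649) concludes, among others, «the realisation `I ≅ i_G(χt)` on `Gqs L w` has a `K_w`-fixed LINE at
`K_w = U(Φ₃)(𝒪_w) = cmLocalIntegralLevel L 3 (qsForm L) w`» (`Module.finrank ℂ ↥(I.fixedPoints KG) = 1`); its payers (p05 (g2) non-split, p06 (g0) split) need that token for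
unramified `χt`.  The `K_v`-line of ★ `cmPrincipalSeries L N v χ` itself is ★ for EVERY `N` and EVERY finite place
`v` (split or not): ★ `UnitaryGroup.isSpherical_cmPrincipalSeries` (`Literature/NumberTheory/Automorphic/CMPrincipalSeriesSpherical.lean` :305; Iwasawa ★
`exists_borel_mul_mem_cmLocalIntegralLevel`, `δ^{1/2} = 1` and `χ = 1` on `B ∩ K_v`).  This file TRANSPORTS it to any realisation `I` along an isomorphism of representations
(★ `Representation.Equiv.fixedPointsCongr`: `V ↦ V^K` is a functor):
* `finrank_fixedPoints_eq_one_of_equiv_cmPrincipalSeries` — generic `N`: `Nonempty (I.Equiv (cmPrincipalSeries L N v χ))`, `χ` trivial on `T ∩ K_v` ⇒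
  `finrank ℂ (I.fixedPoints (cmLocalIntegralLevel L N Φ_N v)) = 1`;
* `finrank_fixedPoints_eq_one_of_equiv_cmPrincipalSeries_three` — the `N = 3` instance on ★ `Gqs L w` with `K_w = cmLocalIntegralLevel L 3 (qsForm L) w` (the token shape
  of ★ `PSLocalCharTransferLetter`'s conclusion `Module.finrank ℂ ↥(I.fixedPoints KG) = 1` at the pin `KG = cmLocalIntegralLevel L 3 (qsForm L) w`).
Valid at EVERY finite `w` (split or not); DEAL #18's letter (M-c) was withdrawn by p06 (g0) (the split reduction reads the line off the unit fundamental lemma instead), so this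
file is filed as the generic brick for whichever payer wants the `K`-line from unramifiedness of `χt` directly.
HONEST LABEL: transport of a ★ Literature theorem; pays no socket; HC_CM is proved only modulo the 7 printed citations (2 remaining named inputs: hLiu418 =
`stmt-HodgeConjecture-24832`, h413 = `stmt-HodgeConjecture-24833`) until rung 0 closes; REL ≠ ★ ≠ BUILT.
-/

set_option autoImplicit false
set_option linter.dupNamespace false

noncomputable section

open scoped RestrictedProduct Matrix MatrixGroups
open Filter MeasureTheory NumberField IsDedekindDomain CompactlySupported
open Literature.NumberTheory.Rogawski1990 Literature.NumberTheory.Automorphic Literature.NumberTheory.Automorphic.UnitaryGroup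
open Literature.NumberTheory.Automorphic.UnitaryGroup.CotangentForms Literature.NumberTheory.GaloisRepresentations
open Summit.HodgeConjecture.HodgeConjecture.Cruxes.H413.K2E1TraceFormulaBeta

namespace Summit.HodgeConjecture.HodgeConjecture.R90.S10

section SphericalLine

variable (L : Type) [Field L] [NumberField L] [IsCMField L]

/-- **THE `K_v`-LINE OF AN UNRAMIFIED PRINCIPAL SERIES, IN ANY REALISATION** (every `N`, every finite place `v` of `L⁺`): if `χ` is a character of the diagonal torus of
`U(Φ_N)(L⁺_v)` trivial on `T ∩ K_v` (`K_v = U(Φ_N)(𝒪_v) =` ★ `cmLocalIntegralLevel L N Φ_N v`) and `I ≅ i_G(χ) =` ★ `cmPrincipalSeries L N v χ`, then `dim I^{K_v} = 1` — ★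
`isSpherical_cmPrincipalSeries` (Iwasawa `G = BK`, [Rogawski1990 §4.5 p. 45; CartierCorvallis1979 §IV.1]) transported along ★ `Representation.Equiv.fixedPointsCongr`.
[cite: Rogawski1990, §4.5 p. 45; §12.2 pp. 173–174] [cite: CartierCorvallis1979, §IV.1 Thm. 4.1] -/
theorem finrank_fixedPoints_eq_one_of_equiv_cmPrincipalSeries (N : ℕ) (v : Pl L)
    (χ : ↥(torusU (conjLocal L (IsCMField.complexConj L) v) (cmLocalForm L N v)) →* ℂˣ)
    (hχ : ∀ t : ↥(torusU (conjLocal L (IsCMField.complexConj L) v) (cmLocalForm L N v)),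
      (t : ↥(unitaryGroupOfForm (conjLocal L (IsCMField.complexConj L) v) (cmLocalForm L N v))) ∈
        cmLocalIntegralLevel L N (Matrix.of fun i j : Fin N => if i.val + j.val + 1 = N then (1 : L) else 0) v → χ t = 1)
    {W : Type} [AddCommGroup W] [Module ℂ W] (I : Representation ℂ ((UnitaryGroup.cmDatum L N (Matrix.of fun i j : Fin N => if i.val + j.val + 1 = N then (1 : L) else 0)).Local v) W)
    (hI : Nonempty (I.Equiv (cmPrincipalSeries L N v χ))) :
    Module.finrank ℂ ↥(I.fixedPoints (cmLocalIntegralLevel L N (Matrix.of fun i j : Fin N => if i.val + j.val + 1 = N then (1 : L) else 0) v)) = 1 := by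
  obtain ⟨e⟩ := hI
  rw [(e.fixedPointsCongr (cmLocalIntegralLevel L N (Matrix.of fun i j : Fin N => if i.val + j.val + 1 = N then (1 : L) else 0) v)).finrank_eq]
  exact isSpherical_cmPrincipalSeries L N v χ hχ

/-- **`N = 3` on ★ `Gqs L w` with `K_w = cmLocalIntegralLevel L 3 (qsForm L) w`** — the token shape of ★ `PSLocalCharTransferLetter`'s conclusion `Module.finrank ℂ ↥(I.fixedPoints KG) = 1`
at the pin `KG = cmLocalIntegralLevel L 3 (qsForm L) w`, for `I ≅ cmPrincipalSeries L 3 w χt` with `χt` trivial on `T ∩ K_w` (valid at every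
finite `w`). [cite: Rogawski1990, §4.5 p. 45; §4.7 pp. 50–51] [cite: CartierCorvallis1979, §IV.1 Thm. 4.1] -/
theorem finrank_fixedPoints_eq_one_of_equiv_cmPrincipalSeries_three (w : Pl L)
    (χt : ↥(torusU (conjLocal L (IsCMField.complexConj L) w) (cmLocalForm L 3 w)) →* ℂˣ)
    (hχt : ∀ t : ↥(torusU (conjLocal L (IsCMField.complexConj L) w) (cmLocalForm L 3 w)),
      (t : ↥(unitaryGroupOfForm (conjLocal L (IsCMField.complexConj L) w) (cmLocalForm L 3 w))) ∈ cmLocalIntegralLevel L 3 (qsForm L) w → χt t = 1)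
    (KG : Subgroup (Gqs L w)) (hKG : KG = cmLocalIntegralLevel L 3 (qsForm L) w)
    {W : Type} [AddCommGroup W] [Module ℂ W] (I : Representation ℂ (Gqs L w) W) (hI : Nonempty (I.Equiv (cmPrincipalSeries L 3 w χt))) :
    Module.finrank ℂ ↥(I.fixedPoints KG) = 1 := by
  subst hKG
  exact finrank_fixedPoints_eq_one_of_equiv_cmPrincipalSeries L 3 w χt hχt I hI

end SphericalLine

end Summit.HodgeConjecture.HodgeConjecture.R90.S10

end
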